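import Mathlib
import Summits.KontsevichZagierPeriods.Zeta5Search.Families.IntegrabilityApplications
import Summits.KontsevichZagierPeriods.Zeta5Search.Families.ConfigurationClasses
import HarnessLib

/-!
# ζ(5) search — Families: Brown's table of configurations IS the list of convergent basic cellular integrals (N ≤ 10)

HONEST FRAMING: systematic search; no irrationality claim unless certified.  CONVERGENCE statements only (the index set
of the cellular search); nothing about the arithmetic of any zeta value.

`Families/ConfigurationClasses.lean` (P2 gen 2) proved, for `N = 5,…,10` and printed seating plans `τ`, that Brown's
combinatorial condition on the basic integrand holds iff `τ` is equivalent (Brown's `D_{2N} × D_{2N}`) to one of the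
kernel-certified representatives `reps5 … reps10` (`𝒞₈ = 17`, `𝒞₉ = 105`, `𝒞₁₀ = 771`).  With the analytic half of
Lemma 3.6 (`Families/IntegrabilityApplications.integrableOn_basic_ofSeating_iff`, P2 gen 3) this becomes a statement
about the INTEGRALS themselves: for every seating plan `τ` of `N` guests and every `M ≥ 0`, the basic cellular integrand
`f_τ^M ω_τ` is integrable on the open simplex IFF `τ` is equivalent to a listed representative
(`integrableOn_basic_eight/nine/ten_iff_exists_reps`), and for `N = 5, 6, 7` iff it is equivalent to the unique /
unique / one of the five printed plans.  [Brown2016, §1.5, Lemma 3.6, App. 2 §10.1]  Standard axioms only.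
-/

noncomputable section

open MeasureTheory Set Finset

namespace Summit.KontsevichZagierPeriods.Zeta5Search.Families.Cellular

open Literature.NumberTheory.Irrationality Literature.NumberTheory.Irrationality.Brown2016 Configurations

variable {σ : List ℕ}

/-- `N = 5`: the basic cellular integral of a seating plan of five guests converges (`M ≥ 0`) iff the plan is
equivalent to a member of `reps5 = [[5,2,4,1,3]]` (Beukers–Rhin–Viola). [Brown2016, Lemma 3.6, App. 2] -/
theorem integrableOn_basic_five_iff_exists_reps (hσ : IsSeating 5 σ) {M : ℤ} (hM : 0 ≤ M) :
    IntegrableOn (basic (ofSeating (ℓ := 2) σ) M) (openSimplex 2) ↔ ∃ τ ∈ reps5, Equivalent 5 σ τ := by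
  rw [integrableOn_basic_ofSeating_iff (ℓ := 2) hσ hM, isConvergent_five_iff_exists_reps5 hσ]

/-- `N = 6`: the same with `reps6` (Rhin–Viola's `ζ(3)` configuration). [Brown2016, Lemma 3.6, App. 2] -/
theorem integrableOn_basic_six_iff_exists_reps (hσ : IsSeating 6 σ) {M : ℤ} (hM : 0 ≤ M) :
    IntegrableOn (basic (ofSeating (ℓ := 3) σ) M) (openSimplex 3) ↔ ∃ τ ∈ reps6, Equivalent 6 σ τ := by
  rw [integrableOn_basic_ofSeating_iff (ℓ := 3) hσ hM, isConvergent_six_iff_exists_reps6 hσ]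

/-- `N = 7`: the same with the five classes `reps7`. [Brown2016, Lemma 3.6, App. 2] -/
theorem integrableOn_basic_seven_iff_exists_reps (hσ : IsSeating 7 σ) {M : ℤ} (hM : 0 ≤ M) :
    IntegrableOn (basic (ofSeating (ℓ := 4) σ) M) (openSimplex 4) ↔ ∃ τ ∈ reps7, Equivalent 7 σ τ := by
  rw [integrableOn_basic_ofSeating_iff (ℓ := 4) hσ hM, isConvergent_seven_iff_exists_reps7 hσ]

/-- **`N = 8` (the Brown–Zudilin arena)**: for every seating plan `τ` of eight guests and `M ≥ 0`, the basic cellular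
integrand `f_τ^M ω_τ` is integrable on `0 < t₁ < ⋯ < t₅ < 1` IFF `τ` is `D₁₆ × D₁₆`-equivalent to one of the `17`
printed configurations `reps8` (`𝒞₈ = 17`, kernel-complete). [Brown2016, §1.5, Lemma 3.6, App. 2 §10.1] -/
theorem integrableOn_basic_eight_iff_exists_reps (hσ : IsSeating 8 σ) {M : ℤ} (hM : 0 ≤ M) :
    IntegrableOn (basic (ofSeating (ℓ := 5) σ) M) (openSimplex 5) ↔ ∃ τ ∈ reps8, Equivalent 8 σ τ := by
  rw [integrableOn_basic_ofSeating_iff (ℓ := 5) hσ hM, isConvergent_eight_iff_exists_reps8 hσ]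

/-- `N = 9`: the same with the `105` classes `Configurations.reps9`. [Brown2016, Lemma 3.6, App. 2 §10.1] -/
theorem integrableOn_basic_nine_iff_exists_reps (hσ : IsSeating 9 σ) {M : ℤ} (hM : 0 ≤ M) :
    IntegrableOn (basic (ofSeating (ℓ := 6) σ) M) (openSimplex 6) ↔ ∃ τ ∈ reps9, Equivalent 9 σ τ := by
  rw [integrableOn_basic_ofSeating_iff (ℓ := 6) hσ hM, isConvergent_nine_iff_exists_reps9 hσ]

/-- `N = 10`: the same with the `771` classes `Cells.ConfigurationsTen.reps10` (fam-brown9's list).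
[Brown2016, Lemma 3.6, App. 2 §10.1] -/
theorem integrableOn_basic_ten_iff_exists_reps (hσ : IsSeating 10 σ) {M : ℤ} (hM : 0 ≤ M) :
    IntegrableOn (basic (ofSeating (ℓ := 7) σ) M) (openSimplex 7) ↔
      ∃ τ ∈ Cells.ConfigurationsTen.reps10, Equivalent 10 σ τ := by
  rw [integrableOn_basic_ofSeating_iff (ℓ := 7) hσ hM, isConvergent_ten_iff_exists_reps10 hσ]

end Summit.KontsevichZagierPeriods.Zeta5Search.Families.Cellular
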